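/-
Copyright: the b2b-balaban T⁴-continuum CRUX team, row NE7b leaf lineage `t4-ne7b-formalise-leaf-01` (gen 83). Project licence.
-/
import Mathlib.Algebra.Order.Chebyshev
import Mathlib.Data.ZMod.Basic
import Mathlib.Algebra.BigOperators.Intervals
import Mathlib.Analysis.Normed.Field.Basic

/-!
# POWER COUNTING IN POSITION SPACE, SECOND HALF: on the discrete torus `ℤ∕N` a translation-invariant quadratic form
# `Q(v) = Σ_m k_m·Σ_x v_x v_{x+m}` is EXACTLY «mass `(Σ_m k_m)·‖v‖²` − ½·Σ_m k_m·D_m(v)» with `D_m(v) = Σ_x (v_{x+m} − v_x)²`; the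
# MARGINAL identity `m²·D₁(v) − D_m(v) = ½·Σ_x Σ_{j,l<m} (∇v_{x+j} − ∇v_{x+l})² ≥ 0` and the IRRELEVANT bound
# `m²·D₁(v) − D_m(v) ≤ ½m⁴·D₂(v)` (`D₂(v) = Σ_x (v_{x+2} − 2v_{x+1} + v_x)²`); hence, for a kernel annihilating constants (`Σ_m k_m = 0`),
# `|Q(v) + ½(Σ_m k_m m²)·D₁(v)| ≤ ¼(Σ_m |k_m| m⁴)·D₂(v)` — the subtracted form is a FOURTH-MOMENT letter times the form of SECOND differences
# (row NE7b, node U5c; kernel lemmas of finite sums)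

Cell `pub-balaban`, sub-cell `t4`, spine estimate NE7b (`T4WeightBudget.RelWeightBound`; the cell's OWN estimate — NOT PRINTED in
[Bałaban 1983–89], NOT PROVED).  Crux-route work under `Spine/NE7b/` by a row leaf on the windowed convexity road (R-P1); NOTHING of
Bałaban's is named as a Lean object, valued or asserted; no `T4Continuum/Support` leaf typed; no `def`; zero `sorry`.  Imports: Mathlib
only — independent of the hub's olean frontier.

WHY.  `…WardKernelDifferenceForm` (WKDF) typed the MARGINAL half of the refuter's R-AHL-g83-1 (c) in position space (mass term = row sum;
zero row sums ⟹ a difference form ≤ W·Dirichlet) and left the SUBTRACTED (fourth-order) half in its NOT-HERE.  THIS FILE types it, on the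
discrete torus `ZMod N` where translations are bijections and no boundary bookkeeping intrudes: the position-space twin of
`…LatticeKernelMoments`' `|Φ(t) + ½(Σ k ω²)t²| ≤ (Σ|k|ω⁴∕6)t⁴` — with `t² ↔ D₁` (first differences) and `t⁴ ↔ D₂` (second differences), the
dictionary the road's window sockets can read directly (`…HessianLocality`'s local letters are position-space).

WHAT IS PROVED ([folklore]; finite sums on `ZMod N`, Mathlib's `Equiv.sum_comp (Equiv.addRight ·)`, `Finset.sum_range_sub`,
`sq_sum_le_card_mul_sum_sq` BY NAME; `v : ZMod N → ℝ`, shifts by naturals `m` cast into `ZMod N`, everything written inline):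
* §1 SHIFT INVARIANCE AND THE MASS TERM: `sum_shift` (`Σ_x f(x+m) = Σ_x f x`), **`sum_mul_shift_eq`** (`Σ_x v_x v_{x+m} = Σ_x v_x² − ½D_m(v)`),
  **`form_eq_mass_sub_half`** (`Σ_m k_m Σ_x v_x v_{x+m} = (Σ_m k_m)·Σ_x v_x² − ½Σ_m k_m D_m(v)` — the mass term is the kernel's total mass,
  as in WKDF §1), `form_eq_neg_half_of_sum_zero` (Ward: `Σ k = 0` ⟹ no mass term).
* §2 THE VARIANCE IDENTITY: `mul_sum_sq_sub_sq_sum` (`m·Σ_{j<m} a_j² − (Σ_{j<m} a_j)² = ½Σ_{j<m}Σ_{l<m} (a_j − a_l)²`).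
* §3 THE MARGINAL IDENTITY: `shift_sub_eq_sum_diff` (telescoping `v_{x+m} − v_x = Σ_{j<m} (v_{x+j+1} − v_{x+j})`),
  **`sq_mul_dirichlet_sub_eq`** (`m²·D₁(v) − D_m(v) = ½Σ_x Σ_{j<m}Σ_{l<m} ((v_{x+j+1} − v_{x+j}) − (v_{x+l+1} − v_{x+l}))²`), whence
  `Dm_le_sq_mul_dirichlet` (`D_m ≤ m²D₁` — the marginal letter of WKDF in torus form).
* §4 THE IRRELEVANT BOUND: `sq_diff_shift_le` (`(∇v_{x+j} − ∇v_{x+l})²` summed over `x` is `≤ (l − j)²·D₂(v)`),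
  **`sq_mul_dirichlet_sub_le`** (`m²·D₁(v) − D_m(v) ≤ ½m⁴·D₂(v)`).
* §5 THE SUBTRACTED FORM: **`abs_form_add_marginal_le`** — `Σ_m k_m = 0` ⟹
  `|Σ_m k_m Σ_x v_x v_{x+m} + ½(Σ_m k_m m²)·D₁(v)| ≤ ¼(Σ_m |k_m| m⁴)·D₂(v)`.
* §6 ANY FINITE ABELIAN GROUP (the torus `(ℤ∕N)ᵈ` included): `sum_shift_group`, `shift_sub_eq_sum_steps`, **`sum_sq_shift_sub_le_path`**
  (THE PATH LETTER: `z = Σ_{j<m} u_j` ⟹ `Σ_x (v(x+z) − v x)² ≤ m·Σ_{j<m} Σ_x (v(x+u_j) − v x)²` — with unit steps the `d`-dimensional marginal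
  letter `D_z ≤ ‖z‖₁·Σ_{steps} D_{e_i}`), `sum_mul_shift_eq_group` (correlation = mass − ½·difference form).
* §7 toy: the torus Laplacian `k₀ = −2, k₁ = 2` (both neighbours folded into `m = 1`): `Σ k = 0`, `Σ k m² = 2`, and the form is `−D₁(v)`
  exactly (`laplacian_form`).

NOT HERE (honest): the sharp constant (`m²(m² − 1)∕12` in place of `½m⁴`, i.e. `∕24` in place of `¼` — `Σ_{j,l<m}(l − j)² = m²(m² − 1)∕6`),
windows with boundary (WKDF §3's straddling bookkeeping would carry over), the FOURTH-order statement on `d > 1` tori (§6 gives only the marginal path letter there),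
the decay evaluation of the fourth moment (LKM `moment_le_of_decay`), and anything of Bałaban's.  BY-NAME EFFECT ON THE WALL: NONE
(a position-space supplier for the road's displayed Hessian letters).  NE7b NOT PRINTED ∕ NOT PROVED; spine PROVED 0∕9; rung (B)+1 on a FINITE
torus — NOT infinite volume, NOT the mass gap, NOT Clay.  HONEST DEPENDENCY: continuum YM on T⁴ ⇐ BetaPertH ∧ nine spine estimates (0∕9
proved); BetaPertH ⇐ (D1) ∧ (D4) ∧ CAP+tail; G-an2-4 gates asym, D1 and NE2∕3∕4.
-/

namespace Summit.QuantumFields.BalabanUV.T4Continuum.NE7b.WardKernelFourthOrder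

open Finset

variable {N : ℕ} [NeZero N]

/-! ## §1 Shift invariance on the torus and the mass term -/

/-- Translations of `ZMod N` are bijections: `Σ_x f(x + c) = Σ_x f x`. [folklore] -/
theorem sum_shift (f : ZMod N → ℝ) (c : ZMod N) : ∑ x, f (x + c) = ∑ x, f x :=
  Equiv.sum_comp (Equiv.addRight c) f

/-- **CORRELATION = MASS − ½·DIFFERENCE FORM** [folklore]: `Σ_x v_x·v_{x+c} = Σ_x v_x² − ½·Σ_x (v_{x+c} − v_x)²`. -/
theorem sum_mul_shift_eq (v : ZMod N → ℝ) (c : ZMod N) :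
    ∑ x, v x * v (x + c) = ∑ x, v x ^ 2 - 1 / 2 * ∑ x, (v (x + c) - v x) ^ 2 := by
  have h : ∑ x, (v (x + c) - v x) ^ 2 = ∑ x, v (x + c) ^ 2 + ∑ x, v x ^ 2 - 2 * ∑ x, v x * v (x + c) := by
    rw [← sum_add_distrib, mul_sum, ← sum_sub_distrib]
    exact sum_congr rfl fun x _ => by ring
  rw [h, sum_shift (fun x => v x ^ 2) c]
  ring

/-- **THE MASS TERM IS THE KERNEL'S TOTAL MASS** [folklore]: for separations `m ∈ Z` with weights `k`,
`Σ_{m∈Z} k_m·Σ_x v_x v_{x+m} = (Σ_{m∈Z} k_m)·Σ_x v_x² − ½·Σ_{m∈Z} k_m·Σ_x (v_{x+m} − v_x)²`. -/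
theorem form_eq_mass_sub_half (Z : Finset ℕ) (k : ℕ → ℝ) (v : ZMod N → ℝ) :
    ∑ m ∈ Z, k m * ∑ x, v x * v (x + m) = (∑ m ∈ Z, k m) * ∑ x, v x ^ 2
      - 1 / 2 * ∑ m ∈ Z, k m * ∑ x, (v (x + m) - v x) ^ 2 := by
  have e : ∀ m ∈ Z, k m * ∑ x, v x * v (x + m)
      = k m * ∑ x, v x ^ 2 - 1 / 2 * (k m * ∑ x, (v (x + m) - v x) ^ 2) := fun m _ => by
    rw [sum_mul_shift_eq]; ring
  rw [sum_congr rfl e, sum_sub_distrib, ← sum_mul, ← mul_sum]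

/-- **WARD KILLS THE MASS TERM** [folklore]: `Σ_m k_m = 0` ⟹ `Σ_m k_m Σ_x v_x v_{x+m} = −½·Σ_m k_m·D_m(v)`. -/
theorem form_eq_neg_half_of_sum_zero (Z : Finset ℕ) (k : ℕ → ℝ) (hW : ∑ m ∈ Z, k m = 0) (v : ZMod N → ℝ) :
    ∑ m ∈ Z, k m * ∑ x, v x * v (x + m) = -(1 / 2) * ∑ m ∈ Z, k m * ∑ x, (v (x + m) - v x) ^ 2 := by
  rw [form_eq_mass_sub_half, hW]; ring

/-! ## §2 The variance identity -/

/-- **VARIANCE IDENTITY** [folklore]: `m·Σ_{j<m} a_j² − (Σ_{j<m} a_j)² = ½·Σ_{j<m} Σ_{l<m} (a_j − a_l)²`. -/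
theorem mul_sum_sq_sub_sq_sum (a : ℕ → ℝ) (m : ℕ) :
    (m : ℝ) * ∑ j ∈ range m, a j ^ 2 - (∑ j ∈ range m, a j) ^ 2
      = 1 / 2 * ∑ j ∈ range m, ∑ l ∈ range m, (a j - a l) ^ 2 := by
  have hrow : ∀ j ∈ range m, ∑ l ∈ range m, (a j - a l) ^ 2
      = (m : ℝ) * a j ^ 2 + (∑ l ∈ range m, a l ^ 2) - 2 * a j * ∑ l ∈ range m, a l := by
    intro j _
    have e : ∀ l ∈ range m, (a j - a l) ^ 2 = a j ^ 2 + a l ^ 2 - 2 * a j * a l := fun l _ => by ring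
    rw [sum_congr rfl e, sum_sub_distrib, sum_add_distrib, sum_const, card_range, nsmul_eq_mul, ← mul_sum]
  have htot : ∑ j ∈ range m, ∑ l ∈ range m, (a j - a l) ^ 2
      = (m : ℝ) * (∑ j ∈ range m, a j ^ 2) + (m : ℝ) * (∑ l ∈ range m, a l ^ 2)
        - 2 * (∑ j ∈ range m, a j) * ∑ l ∈ range m, a l := by
    rw [sum_congr rfl hrow, sum_sub_distrib, sum_add_distrib, sum_const, card_range, nsmul_eq_mul, ← mul_sum,
      ← sum_mul, ← mul_sum]
  rw [htot]; ring

/-! ## §3 The marginal identity: `m²·D₁ − D_m` is a sum of squares -/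

omit [NeZero N] in
/-- **TELESCOPING ON THE TORUS**: `v_{x+m} − v_x = Σ_{j<m} (v_{x+j+1} − v_{x+j})`. [folklore] -/
theorem shift_sub_eq_sum_diff (v : ZMod N → ℝ) (x : ZMod N) (m : ℕ) :
    v (x + m) - v x = ∑ j ∈ range m, (v (x + j + 1) - v (x + j)) := by
  have h := Finset.sum_range_sub (fun j : ℕ => v (x + j)) m
  simp only [Nat.cast_add, Nat.cast_one, ← add_assoc, Nat.cast_zero, add_zero] at h
  exact h.symm

/-- **THE MARGINAL IDENTITY** [folklore]: with `∇v_i = v_{i+1} − v_i`,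
`m²·Σ_x (∇v_x)² − Σ_x (v_{x+m} − v_x)² = ½·Σ_x Σ_{j<m} Σ_{l<m} (∇v_{x+j} − ∇v_{x+l})²` — in particular `D_m ≤ m²·D₁`. -/
theorem sq_mul_dirichlet_sub_eq (v : ZMod N → ℝ) (m : ℕ) :
    (m : ℝ) ^ 2 * ∑ x, (v (x + 1) - v x) ^ 2 - ∑ x, (v (x + m) - v x) ^ 2
      = 1 / 2 * ∑ x, ∑ j ∈ range m, ∑ l ∈ range m,
          ((v (x + j + 1) - v (x + j)) - (v (x + l + 1) - v (x + l))) ^ 2 := by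
  -- `m·D₁ = Σ_x Σ_{j<m} (∇v_{x+j})²` by shift invariance
  have hshift : ∑ x, ∑ j ∈ range m, (v (x + j + 1) - v (x + j)) ^ 2 = (m : ℝ) * ∑ x, (v (x + 1) - v x) ^ 2 := by
    rw [sum_comm]
    have : ∀ j ∈ range m, ∑ x, (v (x + j + 1) - v (x + j)) ^ 2 = ∑ x, (v (x + 1) - v x) ^ 2 := fun j _ => by
      have h := sum_shift (fun y => (v (y + 1) - v y) ^ 2) (j : ZMod N)
      simpa [add_assoc, add_comm, add_left_comm] using h
    rw [sum_congr rfl this, sum_const, card_range, nsmul_eq_mul]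
  -- pointwise variance identity, then sum over `x`
  have hpt : ∀ x, (m : ℝ) * ∑ j ∈ range m, (v (x + j + 1) - v (x + j)) ^ 2 - (v (x + m) - v x) ^ 2
      = 1 / 2 * ∑ j ∈ range m, ∑ l ∈ range m, ((v (x + j + 1) - v (x + j)) - (v (x + l + 1) - v (x + l))) ^ 2 := by
    intro x
    rw [shift_sub_eq_sum_diff v x m]
    exact mul_sum_sq_sub_sq_sum (fun j => v (x + j + 1) - v (x + j)) m
  calc (m : ℝ) ^ 2 * ∑ x, (v (x + 1) - v x) ^ 2 - ∑ x, (v (x + m) - v x) ^ 2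
      = (m : ℝ) * ∑ x, ∑ j ∈ range m, (v (x + j + 1) - v (x + j)) ^ 2 - ∑ x, (v (x + m) - v x) ^ 2 := by
        rw [hshift]; ring
    _ = ∑ x, ((m : ℝ) * ∑ j ∈ range m, (v (x + j + 1) - v (x + j)) ^ 2 - (v (x + m) - v x) ^ 2) := by
        rw [sum_sub_distrib, mul_sum]
    _ = ∑ x, 1 / 2 * ∑ j ∈ range m, ∑ l ∈ range m, ((v (x + j + 1) - v (x + j)) - (v (x + l + 1) - v (x + l))) ^ 2 :=
        sum_congr rfl fun x _ => hpt x
    _ = _ := by rw [mul_sum]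

/-- **THE MARGINAL LETTER, TORUS FORM**: `Σ_x (v_{x+m} − v_x)² ≤ m²·Σ_x (v_{x+1} − v_x)²`. [folklore] -/
theorem Dm_le_sq_mul_dirichlet (v : ZMod N → ℝ) (m : ℕ) :
    ∑ x, (v (x + m) - v x) ^ 2 ≤ (m : ℝ) ^ 2 * ∑ x, (v (x + 1) - v x) ^ 2 := by
  have h := sq_mul_dirichlet_sub_eq v m
  have h0 : 0 ≤ 1 / 2 * ∑ x : ZMod N, ∑ j ∈ range m, ∑ l ∈ range m,
      ((v (x + j + 1) - v (x + j)) - (v (x + l + 1) - v (x + l))) ^ 2 := by positivity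
  linarith

/-! ## §4 The irrelevant bound: `m²·D₁ − D_m ≤ ½m⁴·D₂` -/

/-- One pair `j ≤ l`: summed over the torus, `Σ_x (∇v_{x+j} − ∇v_{x+l})² ≤ (l − j)²·D₂(v)` with `D₂(v) = Σ_x (∇v_{x+1} − ∇v_x)²`
(telescoping `∇v_{x+l} − ∇v_{x+j}` over `l − j` second differences, Cauchy–Schwarz, shift invariance). [folklore] -/
theorem sum_sq_diff_shift_le (v : ZMod N → ℝ) {j l : ℕ} (hjl : j ≤ l) :
    ∑ x, ((v (x + j + 1) - v (x + j)) - (v (x + l + 1) - v (x + l))) ^ 2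
      ≤ ((l : ℝ) - j) ^ 2 * ∑ x, ((v (x + 2) - v (x + 1)) - (v (x + 1) - v x)) ^ 2 := by
  obtain ⟨d, rfl⟩ := Nat.exists_eq_add_of_le hjl
  set w : ZMod N → ℝ := fun y => v (y + 1) - v y with hw
  -- pointwise: `(w(x+j+d) − w(x+j))² ≤ d·Σ_{i<d} (w(x+j+i+1) − w(x+j+i))²`
  have hpt : ∀ x : ZMod N, (w (x + j) - w (x + j + d)) ^ 2 ≤ (d : ℝ) * ∑ i ∈ range d, (w (x + j + i + 1) - w (x + j + i)) ^ 2 := by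
    intro x
    have htel : w (x + j + d) - w (x + j) = ∑ i ∈ range d, (w (x + j + i + 1) - w (x + j + i)) := by
      have h := Finset.sum_range_sub (fun i : ℕ => w (x + j + i)) d
      simp only [Nat.cast_add, Nat.cast_one, ← add_assoc, Nat.cast_zero, add_zero] at h
      exact h.symm
    rw [show (w (x + j) - w (x + j + d)) ^ 2 = (w (x + j + d) - w (x + j)) ^ 2 by ring, htel]
    have h := sq_sum_le_card_mul_sum_sq (s := range d) (f := fun i => w (x + j + i + 1) - w (x + j + i))
    rwa [card_range] at h
  -- sum over `x`, swap, shift invariance: each `i` contributes `D₂`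
  have hD2 : ∀ i ∈ range d, ∑ x : ZMod N, (w (x + j + i + 1) - w (x + j + i)) ^ 2
      = ∑ x : ZMod N, ((v (x + 2) - v (x + 1)) - (v (x + 1) - v x)) ^ 2 := by
    intro i _
    have h := sum_shift (fun y : ZMod N => ((v (y + 2) - v (y + 1)) - (v (y + 1) - v y)) ^ 2) ((j : ZMod N) + i)
    rw [← h]
    refine sum_congr rfl fun x _ => ?_
    simp only [hw]
    ring_nf
  have e1 : ∀ x : ZMod N, ((v (x + j + 1) - v (x + j)) - (v (x + (j + d : ℕ) + 1) - v (x + (j + d : ℕ)))) ^ 2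
      = (w (x + j) - w (x + j + d)) ^ 2 := fun x => by
    simp only [hw, Nat.cast_add, add_assoc]
  calc ∑ x, ((v (x + j + 1) - v (x + j)) - (v (x + (j + d : ℕ) + 1) - v (x + (j + d : ℕ)))) ^ 2
      = ∑ x, (w (x + j) - w (x + j + d)) ^ 2 := sum_congr rfl fun x _ => e1 x
    _ ≤ ∑ x, (d : ℝ) * ∑ i ∈ range d, (w (x + j + i + 1) - w (x + j + i)) ^ 2 := sum_le_sum fun x _ => hpt x
    _ = (d : ℝ) * ∑ i ∈ range d, ∑ x, (w (x + j + i + 1) - w (x + j + i)) ^ 2 := by rw [← mul_sum, sum_comm]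
    _ = (d : ℝ) * ((d : ℝ) * ∑ x, ((v (x + 2) - v (x + 1)) - (v (x + 1) - v x)) ^ 2) := by
        rw [sum_congr rfl hD2, sum_const, card_range, nsmul_eq_mul]
    _ = (((j + d : ℕ) : ℝ) - j) ^ 2 * ∑ x, ((v (x + 2) - v (x + 1)) - (v (x + 1) - v x)) ^ 2 := by push_cast; ring

/-- **THE IRRELEVANT BOUND** [folklore]: `m²·Σ_x (v_{x+1} − v_x)² − Σ_x (v_{x+m} − v_x)² ≤ ½m⁴·Σ_x (v_{x+2} − 2v_{x+1} + v_x)²` (each of the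
`m²` pairs `(j, l)` pays at most `(l − j)² ≤ m²` second-difference forms; the sharp total `m²(m² − 1)∕12` is in NOT-HERE). -/
theorem sq_mul_dirichlet_sub_le (v : ZMod N → ℝ) (m : ℕ) :
    (m : ℝ) ^ 2 * ∑ x, (v (x + 1) - v x) ^ 2 - ∑ x, (v (x + m) - v x) ^ 2
      ≤ 1 / 2 * (m : ℝ) ^ 4 * ∑ x, ((v (x + 2) - v (x + 1)) - (v (x + 1) - v x)) ^ 2 := by
  rw [sq_mul_dirichlet_sub_eq]
  set D2 := ∑ x : ZMod N, ((v (x + 2) - v (x + 1)) - (v (x + 1) - v x)) ^ 2 with hD2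
  have hD2_0 : 0 ≤ D2 := by positivity
  have hpair : ∀ j ∈ range m, ∀ l ∈ range m,
      ∑ x : ZMod N, ((v (x + j + 1) - v (x + j)) - (v (x + l + 1) - v (x + l))) ^ 2 ≤ (m : ℝ) ^ 2 * D2 := by
    intro j hj l hl
    have hjm : (j : ℝ) < m := by exact_mod_cast mem_range.1 hj
    have hlm : (l : ℝ) < m := by exact_mod_cast mem_range.1 hl
    rcases le_total j l with hjl | hlj
    · refine (sum_sq_diff_shift_le v hjl).trans ?_
      have : ((l : ℝ) - j) ^ 2 ≤ (m : ℝ) ^ 2 := by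
        have h0 : (0 : ℝ) ≤ (l : ℝ) - j := by
          have : (j : ℝ) ≤ l := by exact_mod_cast hjl
          linarith
        nlinarith
      exact mul_le_mul_of_nonneg_right this hD2_0
    · have hsym : ∑ x : ZMod N, ((v (x + j + 1) - v (x + j)) - (v (x + l + 1) - v (x + l))) ^ 2
          = ∑ x : ZMod N, ((v (x + l + 1) - v (x + l)) - (v (x + j + 1) - v (x + j))) ^ 2 :=
        sum_congr rfl fun x _ => by ring
      rw [hsym]
      refine (sum_sq_diff_shift_le v hlj).trans ?_
      have : ((j : ℝ) - l) ^ 2 ≤ (m : ℝ) ^ 2 := by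
        have h0 : (0 : ℝ) ≤ (j : ℝ) - l := by
          have : (l : ℝ) ≤ j := by exact_mod_cast hlj
          linarith
        nlinarith
      exact mul_le_mul_of_nonneg_right this hD2_0
  calc 1 / 2 * ∑ x : ZMod N, ∑ j ∈ range m, ∑ l ∈ range m, ((v (x + j + 1) - v (x + j)) - (v (x + l + 1) - v (x + l))) ^ 2
      = 1 / 2 * ∑ j ∈ range m, ∑ l ∈ range m, ∑ x : ZMod N, ((v (x + j + 1) - v (x + j)) - (v (x + l + 1) - v (x + l))) ^ 2 := by
        congr 1
        rw [sum_comm]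
        exact sum_congr rfl fun j _ => sum_comm
    _ ≤ 1 / 2 * ∑ j ∈ range m, ∑ l ∈ range m, (m : ℝ) ^ 2 * D2 := by
        gcongr with j hj l hl
        exact hpair j hj l hl
    _ = 1 / 2 * (m : ℝ) ^ 4 * D2 := by
        rw [sum_const, card_range, sum_const, card_range, nsmul_eq_mul, nsmul_eq_mul]; ring

/-! ## §5 The subtracted form: a fourth-moment letter times the form of second differences -/

/-- **THE SUBTRACTED FORM IS IRRELEVANT** [folklore]: for separations `m ∈ Z` with weights `k` annihilating constants (`Σ_m k_m = 0`),
`|Σ_m k_m·Σ_x v_x v_{x+m} + ½(Σ_m k_m m²)·D₁(v)| ≤ ¼(Σ_m |k_m|·m⁴)·D₂(v)` — the quadratic form minus its (vanishing) mass term minus its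
marginal part `−½(Σ k m²)·D₁` is bounded by the fourth moment of the kernel times the form of SECOND differences. -/
theorem abs_form_add_marginal_le (Z : Finset ℕ) (k : ℕ → ℝ) (hW : ∑ m ∈ Z, k m = 0) (v : ZMod N → ℝ) :
    |∑ m ∈ Z, k m * ∑ x, v x * v (x + m) + 1 / 2 * (∑ m ∈ Z, k m * (m : ℝ) ^ 2) * ∑ x, (v (x + 1) - v x) ^ 2|
      ≤ 1 / 4 * (∑ m ∈ Z, |k m| * (m : ℝ) ^ 4) * ∑ x, ((v (x + 2) - v (x + 1)) - (v (x + 1) - v x)) ^ 2 := by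
  set D1 := ∑ x : ZMod N, (v (x + 1) - v x) ^ 2 with hD1
  set D2 := ∑ x : ZMod N, ((v (x + 2) - v (x + 1)) - (v (x + 1) - v x)) ^ 2 with hD2
  have hD2_0 : 0 ≤ D2 := by positivity
  -- the left member is `½·Σ_m k_m·(m²D₁ − D_m)`
  have e : ∑ m ∈ Z, k m * ∑ x, v x * v (x + m) + 1 / 2 * (∑ m ∈ Z, k m * (m : ℝ) ^ 2) * D1
      = 1 / 2 * ∑ m ∈ Z, k m * ((m : ℝ) ^ 2 * D1 - ∑ x, (v (x + m) - v x) ^ 2) := by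
    rw [form_eq_neg_half_of_sum_zero Z k hW v]
    have hsplit : ∑ m ∈ Z, k m * ((m : ℝ) ^ 2 * D1 - ∑ x, (v (x + m) - v x) ^ 2)
        = (∑ m ∈ Z, k m * (m : ℝ) ^ 2) * D1 - ∑ m ∈ Z, k m * ∑ x, (v (x + m) - v x) ^ 2 := by
      rw [sum_mul, ← sum_sub_distrib]
      exact sum_congr rfl fun m _ => by ring
    rw [hsplit]; ring
  rw [e, abs_mul, abs_of_pos (by norm_num : (0 : ℝ) < 1 / 2)]
  have hterm : ∀ m ∈ Z, |k m * ((m : ℝ) ^ 2 * D1 - ∑ x, (v (x + m) - v x) ^ 2)| ≤ |k m| * (1 / 2 * (m : ℝ) ^ 4 * D2) := by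
    intro m _
    rw [abs_mul]
    refine mul_le_mul_of_nonneg_left ?_ (abs_nonneg _)
    have h1 : 0 ≤ (m : ℝ) ^ 2 * D1 - ∑ x, (v (x + m) - v x) ^ 2 := by
      have := Dm_le_sq_mul_dirichlet v m; linarith
    rw [abs_of_nonneg h1]
    exact sq_mul_dirichlet_sub_le v m
  calc 1 / 2 * |∑ m ∈ Z, k m * ((m : ℝ) ^ 2 * D1 - ∑ x, (v (x + m) - v x) ^ 2)|
      ≤ 1 / 2 * ∑ m ∈ Z, |k m| * (1 / 2 * (m : ℝ) ^ 4 * D2) := by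
        gcongr
        exact (abs_sum_le_sum_abs _ _).trans (sum_le_sum hterm)
    _ = 1 / 4 * (∑ m ∈ Z, |k m| * (m : ℝ) ^ 4) * D2 := by
        have hs : ∑ m ∈ Z, |k m| * (1 / 2 * (m : ℝ) ^ 4 * D2) = (1 / 2 * D2) * ∑ m ∈ Z, |k m| * (m : ℝ) ^ 4 := by
          rw [mul_sum]; exact sum_congr rfl fun m _ => by ring
        rw [hs]; ring

/-! ## §6 Any finite abelian group (the `d`-dimensional torus included): the PATH LETTER -/

section Path

variable {G : Type*} [AddCommGroup G] [Fintype G]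

/-- Translations of a finite abelian group are bijections: `Σ_x f(x + c) = Σ_x f x`. [folklore] -/
theorem sum_shift_group (f : G → ℝ) (c : G) : ∑ x, f (x + c) = ∑ x, f x :=
  Equiv.sum_comp (Equiv.addRight c) f

omit [Fintype G] in
/-- **TELESCOPING ALONG A PATH**: with steps `u j` and partial sums `S_j = Σ_{i<j} u i`,
`v(x + S_m) − v(x) = Σ_{j<m} (v(x + S_{j+1}) − v(x + S_j))`. [folklore] -/
theorem shift_sub_eq_sum_steps (v : G → ℝ) (x : G) (u : ℕ → G) (m : ℕ) :
    v (x + ∑ i ∈ range m, u i) - v x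
      = ∑ j ∈ range m, (v (x + ∑ i ∈ range (j + 1), u i) - v (x + ∑ i ∈ range j, u i)) := by
  have h := Finset.sum_range_sub (fun j : ℕ => v (x + ∑ i ∈ range j, u i)) m
  simp only [sum_range_zero, add_zero] at h
  exact h.symm

/-- **THE PATH LETTER** [folklore]: on any finite abelian group, for a separation written as a sum of `m` steps `z = Σ_{j<m} u j`,
`Σ_x (v(x + z) − v x)² ≤ m·Σ_{j<m} Σ_x (v(x + u j) − v x)²` — on the torus `(ℤ∕N)ᵈ` with unit steps `±e_i` this is the `d`-dimensional
MARGINAL letter `D_z ≤ ‖z‖₁·Σ_{steps} D_{e_i} ≤ ‖z‖₁²·max_i D_{e_i}` (telescoping, Cauchy–Schwarz, shift invariance per step). -/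
theorem sum_sq_shift_sub_le_path (v : G → ℝ) (u : ℕ → G) (m : ℕ) :
    ∑ x, (v (x + ∑ i ∈ range m, u i) - v x) ^ 2 ≤ (m : ℝ) * ∑ j ∈ range m, ∑ x, (v (x + u j) - v x) ^ 2 := by
  have hpt : ∀ x : G, (v (x + ∑ i ∈ range m, u i) - v x) ^ 2
      ≤ (m : ℝ) * ∑ j ∈ range m, (v (x + ∑ i ∈ range (j + 1), u i) - v (x + ∑ i ∈ range j, u i)) ^ 2 := by
    intro x
    rw [shift_sub_eq_sum_steps v x u m]
    have h := sq_sum_le_card_mul_sum_sq (s := range m)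
      (f := fun j => v (x + ∑ i ∈ range (j + 1), u i) - v (x + ∑ i ∈ range j, u i))
    rwa [card_range] at h
  have hstep : ∀ j ∈ range m, ∑ x : G, (v (x + ∑ i ∈ range (j + 1), u i) - v (x + ∑ i ∈ range j, u i)) ^ 2
      = ∑ x : G, (v (x + u j) - v x) ^ 2 := by
    intro j _
    have h := sum_shift_group (fun y : G => (v (y + u j) - v y) ^ 2) (∑ i ∈ range j, u i)
    rw [← h]
    refine sum_congr rfl fun x _ => ?_
    rw [sum_range_succ, ← add_assoc]
  calc ∑ x, (v (x + ∑ i ∈ range m, u i) - v x) ^ 2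
      ≤ ∑ x, (m : ℝ) * ∑ j ∈ range m, (v (x + ∑ i ∈ range (j + 1), u i) - v (x + ∑ i ∈ range j, u i)) ^ 2 :=
        sum_le_sum fun x _ => hpt x
    _ = (m : ℝ) * ∑ j ∈ range m, ∑ x, (v (x + ∑ i ∈ range (j + 1), u i) - v (x + ∑ i ∈ range j, u i)) ^ 2 := by
        rw [← mul_sum, sum_comm]
    _ = (m : ℝ) * ∑ j ∈ range m, ∑ x, (v (x + u j) - v x) ^ 2 := by rw [sum_congr rfl hstep]

/-- **CORRELATION = MASS − ½·DIFFERENCE FORM on any finite abelian group** (the `d`-dimensional torus' version of §1):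
`Σ_x v_x·v_{x+z} = Σ_x v_x² − ½·Σ_x (v_{x+z} − v_x)²`. [folklore] -/
theorem sum_mul_shift_eq_group (v : G → ℝ) (z : G) :
    ∑ x, v x * v (x + z) = ∑ x, v x ^ 2 - 1 / 2 * ∑ x, (v (x + z) - v x) ^ 2 := by
  have h : ∑ x, (v (x + z) - v x) ^ 2 = ∑ x, v (x + z) ^ 2 + ∑ x, v x ^ 2 - 2 * ∑ x, v x * v (x + z) := by
    rw [← sum_add_distrib, mul_sum, ← sum_sub_distrib]
    exact sum_congr rfl fun x _ => by ring
  rw [h, sum_shift_group (fun x => v x ^ 2) z]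
  ring

end Path

/-! ## §7 Toy: the torus Laplacian -/

/-- The torus Laplacian in one-sided form (`k 0 = −2`, `k 1 = 2`: both neighbours folded into the separation `m = 1`) annihilates constants
(`Σ k = 0`), has marginal coefficient `−½·Σ k m² = −1`, and its form is EXACTLY `−D₁(v)` — the subtracted form vanishes. [folklore] -/
theorem laplacian_form (v : ZMod N → ℝ) :
    ∑ m ∈ ({0, 1} : Finset ℕ), (if m = 0 then (-2 : ℝ) else 2) * ∑ x, v x * v (x + m)
      = -∑ x, (v (x + 1) - v x) ^ 2 := by
  rw [sum_insert (by decide), sum_singleton]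
  simp only [if_true, show (1 : ℕ) ≠ 0 by decide, if_false, Nat.cast_zero, add_zero, Nat.cast_one]
  rw [sum_mul_shift_eq v 1]
  have h0 : ∑ x : ZMod N, v x * v x = ∑ x : ZMod N, v x ^ 2 := sum_congr rfl fun x _ => by ring
  rw [h0]
  ring

end Summit.QuantumFields.BalabanUV.T4Continuum.NE7b.WardKernelFourthOrder
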